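import Summits.BirchSwinnertonDyer.BirchSwinnertonDyer.Theorems.KimAtThreeD7uTamagawaSharp
import Summits.BirchSwinnertonDyer.BirchSwinnertonDyer.Theorems.KimAtThreeD7uTamagawaDefectExponentLe
import HarnessLib

/-!
# The TAMAGAWA-DIVISIBLE bad places, XVII-le: the EXACT THRESHOLD `max_ℓ v₃(c_ℓ)` with the level families
# BOUNDED BY THE TARGET DEPTH — the CONSUMER form of part XVII's ★★ iff
# (cell `bsd-addord`, seat w2-tamdiv gen 7; route W2 `KimAtThreeKolyvagin`, items 19562 / 19679 / 19599 / 19560, «TamDiv∞»)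

HONEST FRAMING: TOOL theorem (no definition, no named fact, no `sorry`); closes nothing by itself; nothing is
booked; BSD is not proved by any of this.  Part XVII's ★★
`KimAtThreeD7uTamagawaSharp.kolyvaginSystems_blochKatoRelaxed_eq_bot_iff_exists_pow_succ_dvd` (p535902) takes
`hD : ∀ j, (D j).HasCanonicalComparison (3^{j+1}) η` and `hadm : ∀ j, (D j).IsAdmissible` for EVERY `j` on ONE
prime set — a family no curve satisfies (see the module docstring of `KimAtThreeD7uTamagawaDefectExponentLe`:
THE canonical comparison map at level `3^{j+1}` needs `3^{j+1} ∣ #Ẽ(𝔽_𝔮)`).  This file restates it with `hD`,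
`hadm` asked for `j ≤ k` ONLY (every other binder VERBATIM), over part XV-le; the proof is part XVII's, whose
(⇒) direction uses the data at the levels `0` and `k` only (§6 `kolyvaginSystems_blochKatoRelaxed_ne_bot_of_exists_ne_zero`)
and whose (⇐) direction is part XV.  Part XXVI (`KimAtThreeD7uTamagawaKuriharaTower.exists_pinnedData_of_towerSurj`)
constructs the bounded families for every `3`-adic-tower row.  Parts XVIII–XXI admit the same restatement.

References: K. Büyükboduk, JNT 129 (2009) Thm. 3.1, Cor. 3.3, §4.2; B. Mazur, K. Rubin, Mem. AMS 799 (2004)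
Prop. 6.2.6, Thm. 4.4.1, App. A Remark A.5; R. Sakamoto, JTNB 36 (2024) Thm. 4.4 (1); K. Rubin, PCMI 18 (2011) Def. 1.9.6.
-/

noncomputable section

-- the cell's Theorems namespace `Summit.BirchSwinnertonDyer.BirchSwinnertonDyer.…` repeats the summit name by design (D-0017)
set_option linter.dupNamespace false

open scoped Classical NumberField ContRepresentation
open Function Field NumberField IsDedekindDomain Module
open WeierstrassCurve Literature.NumberTheory.EllipticCurves Literature.NumberTheory.GaloisRepresentations
  Literature.NumberTheory.GaloisRepresentations.DiscreteGaloisModule Literature.NumberTheory.GaloisCohomology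
open Summit.BirchSwinnertonDyer.Rank1Residual Summit.BirchSwinnertonDyer.Rank1Residual.GaloisImage
open Summit.BirchSwinnertonDyer.BirchSwinnertonDyer.Theorems.KimAtThreeD7uTamagawaDefectDevissage

namespace Summit.BirchSwinnertonDyer.BirchSwinnertonDyer.Theorems.KimAtThreeD7uTamagawaSharp

section ThreeLe

variable (W : WeierstrassCurve ℚ) [W.IsElliptic]

/-- ★★-le **`KS(E[3^k·3], 𝓕_u, D k) = 0 ⟺ 3^{k+1} ∣ c_ℓ` for SOME finite `ℓ ∤ 3` — CONSUMER FORM** (part XVII's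
★★ with the canonical comparison maps and admissibility asked for the levels `j ≤ k` only; every other binder
and the conclusion VERBATIM).  The Kolyvagin-system form of «TamDiv∞» is governed by `max_ℓ v₃(c_ℓ)`.
[cite: Buyukboduk2009TamagawaDefect, Thm. 3.1, Cor. 3.3 and §4.2 Questions 1–2 (p. 12)]
[cite: MazurRubin2004, Prop. 6.2.6 (p. 75) and App. A Remark A.5 (p. 81)] [cite: Rubin2011, Def. 1.9.6 (p. 14)] -/
theorem kolyvaginSystems_blochKatoRelaxed_eq_bot_iff_exists_pow_succ_dvd_le [Finite (geomTorsion W ((3 : ℕ) : ℤ))]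
    [Finite (geomTorsion W (((3 : ℕ) : ℤ) ^ 0 * ((3 : ℕ) : ℤ)))]
    {inv : LocalInvariants ℚ 3}
    (hperf : inv.IsPerfect) (hsum : inv.SumLocalTermEqZero) (hcompl : inv.SelmerComplement)
    (hEP : ∀ v : HeightOneSpectrum (𝓞 ℚ), localEulerPoincareCharacteristic (v.adicCompletion ℚ))
    (T : Finset (HeightOneSpectrum (𝓞 ℚ)))
    (h3T : ∀ v : HeightOneSpectrum (𝓞 ℚ), ((3 : ℕ) : 𝓞 ℚ) ∈ v.asIdeal → v ∈ T)
    (hbadT : ∀ v : HeightOneSpectrum (𝓞 ℚ), ¬ W.HasGoodReductionAt v → v ∈ T) (k : ℕ)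
    (h0 : ∀ (j : ℕ) (P : geomTorsion W (((3 : ℕ) : ℤ) ^ j * ((3 : ℕ) : ℤ))),
      (∀ σ : absoluteGaloisGroup ℚ,
        W.torsionGaloisModule (((3 : ℕ) : ℤ) ^ j * ((3 : ℕ) : ℤ)) σ P = P) → P = 0)
    {Sset : Set (HeightOneSpectrum (𝓞 ℚ))} {τ : absoluteGaloisGroup ℚ}
    (hτ : ∀ j : ℕ, Nonempty (cokerSubOne (W.torsionGaloisModule (((3 : ℕ) : ℤ) ^ j * ((3 : ℕ) : ℤ))) τ ≃+
      ZMod (3 ^ (j + 1))))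
    (hτ₁ : Nonempty (cokerSubOne (W.torsionGaloisModule ((3 : ℕ) : ℤ)) τ ≃+ ZMod 3))
    (hτμ : τ ∈ rootsOfUnityFixer ℚ (3 ^ (k + 1)))
    (D : (j : ℕ) → KolyvaginDatum (W.torsionGaloisModule (((3 : ℕ) : ℤ) ^ j * ((3 : ℕ) : ℤ))))
    {P : Set (HeightOneSpectrum (𝓞 ℚ))} (hP : ∀ j, (D j).primes = P) (hPT : ∀ q ∈ P, q ∉ T)
    (hPc : P ⊆ frobeniusClassPrimes
      (W.torsionGaloisModule (((3 : ℕ) : ℤ) ^ k * ((3 : ℕ) : ℤ))) Sset τ (3 ^ (k + 1)))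
    (hT : ∀ j, (D j).transverse = cyclotomicTransverse _)
    {η : (q : HeightOneSpectrum (𝓞 ℚ)) → (ZMod (Ideal.absNorm q.asIdeal))ˣ}
    (hD : ∀ j, j ≤ k → (D j).HasCanonicalComparison (3 ^ (j + 1)) η) (hadm : ∀ j, j ≤ k → (D j).IsAdmissible)
    (hprime : ∀ c : galoisCohomology (W.torsionGaloisModule (((3 : ℕ) : ℤ) ^ 0 * ((3 : ℕ) : ℤ))) 1, c ≠ 0 →
      ∀ c' : galoisCohomology (DiscreteGaloisModule.tateDual
        (W.torsionGaloisModule (((3 : ℕ) : ℤ) ^ 0 * ((3 : ℕ) : ℤ))) 3) 1, c' ≠ 0 →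
      {q ∈ (D 0).primes |
        galoisCohomology.localization (W.torsionGaloisModule (((3 : ℕ) : ℤ) ^ 0 * ((3 : ℕ) : ℤ)))
          (Sum.inr q) 1 c ≠ 0 ∧
        galoisCohomology.localization (DiscreteGaloisModule.tateDual
          (W.torsionGaloisModule (((3 : ℕ) : ℤ) ^ 0 * ((3 : ℕ) : ℤ))) 3) (Sum.inr q) 1 c' ≠ 0}.Infinite)
    (hne : ∃ κ : Finset (HeightOneSpectrum (𝓞 ℚ)) →
        galoisCohomology (W.torsionGaloisModule (((3 : ℕ) : ℤ) ^ 0 * ((3 : ℕ) : ℤ))) 1,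
      (D 0).IsKolyvaginSystem (propagatedSelmerStructure W 3 0) κ ∧ κ ≠ 0) :
    (D k).kolyvaginSystems (blochKatoSelmerStructure 3 (tateTorsionDatum W 3 k) (fun _ _ => ⊤)) = ⊥ ↔
      ∃ ℓ : HeightOneSpectrum (𝓞 ℚ), ((3 : ℕ) : 𝓞 ℚ) ∉ ℓ.asIdeal ∧
        3 ^ (k + 1) ∣ (W.baseChange (ℓ.adicCompletion ℚ)).localTamagawaNumber (ℓ.adicCompletionIntegers ℚ) := by
  haveI : Fact (Nat.Prime 3) := ⟨Nat.prime_three⟩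
  constructor
  · -- (⇒): if no Tamagawa number is divisible by `3^{k+1}`, `incl_* KS(E[3], 𝓕_can) ≠ 0` sits inside
    intro hbot
    by_contra hno
    refine kolyvaginSystems_blochKatoRelaxed_ne_bot_of_exists_ne_zero W 3 (Nat.zero_le k) ?_ (h0 k) T h3T
      hbadT ((hP k).trans (hP 0).symm) (fun q hq => hPT q ((hP 0) ▸ hq)) (hT 0) (hT k) (hD 0 (Nat.zero_le k))
      (hD k le_rfl) hne hbot
    intro w hw
    rw [Nat.sub_zero]
    refine pow_dvd_pow 3 ?_
    have hlt : ¬ 3 ^ (k + 1) ∣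
        (W.baseChange (w.adicCompletion ℚ)).localTamagawaNumber (w.adicCompletionIntegers ℚ) :=
      fun h => hno ⟨w, hw, h⟩
    rw [padicValNat_dvd_iff_le (Additive.localTamagawaNumber_adicCompletion_ne_zero W w)] at hlt
    omega
  · -- (⇐): part XV, one Tamagawa prime suffices
    rintro ⟨ℓ, h3ℓ, hk⟩
    exact kolyvaginSystems_blochKatoRelaxed_eq_bot_of_pow_succ_dvd_le W hperf hsum hcompl hEP T h3T hbadT h3ℓ k
      hk h0 hτ hτ₁ hτμ D hP hPT hPc hT hD hadm hprime

end ThreeLe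

end Summit.BirchSwinnertonDyer.BirchSwinnertonDyer.Theorems.KimAtThreeD7uTamagawaSharp

end
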